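import Summits.NavierStokesRegularity.NavierStokesRegularity.Theses.CoriolisHead
import Summits.NavierStokesRegularity.NavierStokesRegularity.Theorems.CoriolisHeadNoCoRotatingCoreSmallAmplitude
import Literature.Analysis.FluidPDE.NSSuitableESSRefutation
import Literature.Analysis.FluidPDE.EulerBilinearSymbol
import HarnessLib

/-!
# Route CoriolisHead · crux `NoCoRotatingCore` (stmt-NavierStokesRegularity-22676) —
# BOUNDEDNESS IS LOAD-BEARING: explicit unbounded rotated profiles with NEGATIVE Coriolis defect

Support file (`--supports stmt-NavierStokesRegularity-22676`; theorems only, no definitions, no named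
facts).  The refuter's one-pass note on the crux (2026-08-27) recorded, on paper, that the boundedness
hypothesis of `NoCoRotatingCore` cannot be dropped: linear profiles `U = Ly`,
`L = diag(s, −2a−s, 2a) + κJ`, `B = βJ`, with a quadratic pressure, solve the rotated Leray profile
system with constant defect `tr(B∘L) = −2βκ` of either sign.  This file lands the kernel version of
the case `s = 0`, `κ = β = 1`:

* `exists_unbounded_rotatedProfile_neg_defect` — for every `ν` and every `a`, the smooth
  divergence-free UNBOUNDED field `U(y) = (−y₁, y₀ − 2a y₁, 2a y₂)` with the quadratic pressure
  `P(y) = −½⟪y, Sy⟫`, `S = 2aL + [J, L] + L²` (symmetric: `Sy = (−y₀ + 2a y₁, 2a y₀ − y₁, 8a² y₂)`),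
  solves `−νΔU + aU + a DU[y] + (JU − DU[Jy]) + DU[U] + ∇P = 0` with the skew frame rate `J = e₃ × ·`,
  and its Coriolis defect is `Σₗ (J ∂ₗU)ₗ = −2 < 0` at EVERY point.

So the conclusion of the crux fails for genuine (unbounded) solutions of its system: the sign
convention `Σₗ (B ∂ₗU)ₗ = tr(B∘DU) = −β·curl U` is not vacuously nonnegative, and every proof of
`NoCoRotatingCore` must use `sup |U| < ∞` (cf. the decided regime `sup|U|² < ε·aν` of
`CoriolisHeadNoCoRotatingCoreSmallAmplitude`).

HONEST FRAMING.  A non-example outside the crux's class (unbounded); it refutes nothing that is filed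
and proves nothing about bounded profiles; Navier–Stokes regularity is NOT proved here.

References: refuter note on stmt-NavierStokesRegularity-22676 (NS4-BATCH-NOTES.md, 2026-08-27);
B. Pineau, V. Vicol, arXiv:2607.09619, (1.8) [PineauVicol2026]; P. G. Drazin, *Introduction to
Hydrodynamic Stability* (2002), Ex. 2.19 (linear flows with quadratic pressure) [Drazin2002].
-/

noncomputable section

-- the summit and its single sub-problem share the name (CONVENTIONS §1), as in every Theorems file
set_option linter.dupNamespace false

open Set Function
open scoped ContDiff Laplacian RealInnerProductSpace BigOperators
open Literature.Analysis.FluidPDE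

namespace Summit.NavierStokesRegularity.NavierStokesRegularity.Theorems.CoriolisHead

/-- **Unbounded rotated profiles with negative Coriolis defect (boundedness is load-bearing in
`NoCoRotatingCore`).**  For every `ν, a ∈ ℝ` there are a skew `B` (namely `J = e₃ × ·`), a smooth
divergence-free `U` (namely the linear field `U(y) = (−y₁, y₀ − 2a y₁, 2a y₂)`, unbounded for
`a ≠ 0` — indeed for all `a`, through the first two components) and a `C²` pressure `P` (quadratic)
solving the rotated Leray profile system `−νΔU + aU + a DU[y] + (BU − DU[By]) + DU[U] + ∇P = 0`, such
that `U` is unbounded and the defect `Σₗ (B ∂ₗU(y))ₗ` equals `−2` at every point.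
[cite: PineauVicol2026, (1.8) (arXiv:2607.09619 p. 3); Drazin2002, Ex. 2.19] -/
theorem exists_unbounded_rotatedProfile_neg_defect (ν a : ℝ) :
    ∃ (B : EuclideanSpace ℝ (Fin 3) →L[ℝ] EuclideanSpace ℝ (Fin 3))
      (U : EuclideanSpace ℝ (Fin 3) → EuclideanSpace ℝ (Fin 3)) (P : EuclideanSpace ℝ (Fin 3) → ℝ),
      ContDiff ℝ (⊤ : ℕ∞) U ∧ ContDiff ℝ 2 P ∧ (∀ x, inner ℝ (B x) x = 0) ∧
      Literature.Analysis.FluidPDE.VectorCalculus.IsDivFree U ∧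
      (∀ y, -(ν • Laplacian.laplacian U y) + a • U y + a • fderiv ℝ U y y + (B (U y) - fderiv ℝ U y (B y))
        + Literature.Analysis.FluidPDE.convect U U y + gradient P y = 0) ∧
      (∀ M : ℝ, ∃ y, M < ‖U y‖) ∧
      ∀ y, ∑ l, (B (fderiv ℝ U y (EuclideanSpace.single l 1))) l = -2 := by
  -- the linear field `L y = (−y₁, y₀ − 2a y₁, 2a y₂) = D y + J y`, `D = diag(0, −2a, 2a)`
  set P1 : EuclideanSpace ℝ (Fin 3) →L[ℝ] EuclideanSpace ℝ (Fin 3) :=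
    (EuclideanSpace.proj (1 : Fin 3) : EuclideanSpace ℝ (Fin 3) →L[ℝ] ℝ).smulRight
      (EuclideanSpace.single (1 : Fin 3) (1 : ℝ)) with hP1
  set P2 : EuclideanSpace ℝ (Fin 3) →L[ℝ] EuclideanSpace ℝ (Fin 3) :=
    (EuclideanSpace.proj (2 : Fin 3) : EuclideanSpace ℝ (Fin 3) →L[ℝ] ℝ).smulRight
      (EuclideanSpace.single (2 : Fin 3) (1 : ℝ)) with hP2
  set L : EuclideanSpace ℝ (Fin 3) →L[ℝ] EuclideanSpace ℝ (Fin 3) :=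
    (-(2 * a)) • P1 + (2 * a) • P2 + rotGenL with hLdef
  have hL : ∀ u : EuclideanSpace ℝ (Fin 3),
      L u = WithLp.toLp 2 ![-(u 1), u 0 - 2 * a * u 1, 2 * a * u 2] := by
    intro u
    ext j
    fin_cases j <;> simp [hLdef, hP1, hP2, rotGenL_apply, rotGen]
    ring
  -- the symmetric matrix `S = 2aL + [J, L] + L²`
  set S : EuclideanSpace ℝ (Fin 3) →L[ℝ] EuclideanSpace ℝ (Fin 3) :=
    (2 * a) • L + (rotGenL.comp L - L.comp rotGenL) + L.comp L with hSdef
  have hS : ∀ u : EuclideanSpace ℝ (Fin 3),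
      S u = WithLp.toLp 2 ![-(u 0) + 2 * a * u 1, 2 * a * u 0 - u 1, 8 * a ^ 2 * u 2] := by
    intro u
    have e : S u = (2 * a) • L u + (rotGen (L u) - L (rotGen u)) + L (L u) := by
      simp [hSdef, rotGenL_apply]
    rw [e]
    ext j
    fin_cases j <;> simp [hL, rotGen] <;> ring
  have hSsymm : ∀ u v : EuclideanSpace ℝ (Fin 3), ⟪u, S v⟫ = ⟪S u, v⟫ := by
    intro u v
    rw [hS, hS]
    simp only [PiLp.inner_apply, RCLike.inner_apply, conj_trivial, Fin.sum_univ_three]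
    simp
    ring
  -- the pressure and its gradient
  set P : EuclideanSpace ℝ (Fin 3) → ℝ := fun y => -(2⁻¹ : ℝ) * ⟪y, S y⟫ with hPdef
  have hPgrad : ∀ y, gradient P y = -(S y) := by
    intro y
    have hq : HasFDerivAt (fun y : EuclideanSpace ℝ (Fin 3) => ⟪y, S y⟫)
        ((fderivInnerCLM ℝ ((id y : EuclideanSpace ℝ (Fin 3)), S y)).comp
          ((ContinuousLinearMap.id ℝ _).prod S)) y :=
      (hasFDerivAt_id y).inner ℝ S.hasFDerivAt
    have hP' : HasFDerivAt P ((-(2⁻¹ : ℝ)) • ((fderivInnerCLM ℝ ((id y : EuclideanSpace ℝ (Fin 3)), S y)).comp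
          ((ContinuousLinearMap.id ℝ _).prod S))) y := by
      simpa [hPdef] using hq.const_mul (-(2⁻¹ : ℝ))
    refine ext_inner_right ℝ fun v => ?_
    rw [gradient, hP'.fderiv, InnerProductSpace.toDual_symm_apply]
    simp only [smul_apply, ContinuousLinearMap.comp_apply,
      ContinuousLinearMap.prod_apply, ContinuousLinearMap.id_apply, fderivInnerCLM_apply, id,
      smul_eq_mul]
    rw [hSsymm y v, real_inner_comm (S y) v, inner_neg_left]
    ring
  have hPsmooth : ContDiff ℝ 2 P := by
    have h1 : ContDiff ℝ 2 fun y : EuclideanSpace ℝ (Fin 3) => ⟪y, S y⟫ :=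
      contDiff_id.inner ℝ S.contDiff
    simpa [hPdef] using h1.const_smul (-(2⁻¹ : ℝ))
  refine ⟨rotGenL, (L : EuclideanSpace ℝ (Fin 3) → EuclideanSpace ℝ (Fin 3)), P, L.contDiff,
    hPsmooth, inner_rotGenL_self, ?_, ?_, ?_, ?_⟩
  · -- `div U = tr L = 0 − 2a + 2a = 0`
    intro y
    rw [divergence_eq_sum_coord, ContinuousLinearMap.fderiv]
    simp only [Fin.sum_univ_three, hL]
    simp
  · -- the profile system
    intro y
    rw [laplacian_clm_apply L y, smul_zero, neg_zero, zero_add, convect_apply,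
      ContinuousLinearMap.fderiv, hPgrad]
    simp only [rotGenL_apply]
    have e : S y = (2 * a) • L y + (rotGen (L y) - L (rotGen y)) + L (L y) := by
      simp [hSdef, rotGenL_apply]
    rw [e]
    module
  · -- unbounded: `U(c, 0, 0) = (0, c, 0)` has norm `|c|`
    intro M
    refine ⟨WithLp.toLp 2 ![|M| + 1, 0, 0], ?_⟩
    have h2 : L (WithLp.toLp 2 ![|M| + 1, 0, 0]) = WithLp.toLp 2 ![0, |M| + 1, 0] := by
      rw [hL]
      ext j
      fin_cases j <;> simp
    have h3 : ‖(WithLp.toLp 2 ![0, |M| + 1, 0] : EuclideanSpace ℝ (Fin 3))‖ = |M| + 1 := by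
      rw [EuclideanSpace.norm_eq]
      simp only [Fin.sum_univ_three]
      simp [Real.sqrt_sq_eq_abs, abs_of_pos (show (0:ℝ) < |M| + 1 by positivity)]
    rw [h2, h3]
    linarith [le_abs_self M]
  · -- the defect `Σₗ (J L eₗ)ₗ = −2`
    intro y
    rw [ContinuousLinearMap.fderiv]
    simp only [Fin.sum_univ_three, rotGenL_apply, hL]
    simp [rotGen]
    ring

end Summit.NavierStokesRegularity.NavierStokesRegularity.Theorems.CoriolisHead

end
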